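import Literature.AnabelianGeometry.EtaleTheta.SettingModelSemidirectTopology
import Literature.AnabelianGeometry.EtaleTheta.SettingModel2Theta
import HarnessLib

/-!
# Root models of [EtTh] §1: closures of `inl`-images in `N ⋊_φ G` and the level maps on `[[Δ̂,Δ̂],Δ̂]⁻ ⊆ F̂₂ ⋊ G`

Mochizuki, *The étale theta function …*, Publ. RIMS **45** (2009) [EtTh], §1, PRIMS PDF pp. 12–14
[cite: MochizukiEtTh2009, §1 p.12]: "`Δ^Θ_X := Δ_X/[Δ_X,[Δ_X,Δ_X]]`". Layer L2 of the abc-iut cell, seat abc-iut-L2-t1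
(root owner); prelude of file F5b of the χ-twisted root model (abc-iut R78 (B), file map R100), generic over the Galois
factor so that it does not wait for F4 (β): (1) for a CLOSED-EMBEDDING homomorphism `f`, `map f` commutes with
topological closure; (2) in a semidirect product `N ⋊_φ G` topologised through `g ↦ (g.left, g.right)`
(abc-iut-w5-d249's `SettingModelSemidirectTopology`), `inl : N → N ⋊ G` is a closed embedding when `N` is compact and
`G` Hausdorff; (3) consequently, for `Π := F̂₂ ⋊_ψ G`, an element of the closure of `inl([[F̂₂,F̂₂],F̂₂])` — which is
`[[Δ̂,Δ̂],Δ̂]⁻` once `Δ̂ = inl(F̂₂)` — has trivial `G`-component and its `F̂₂`-component dies under EVERY level map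
`ĥ_N : F̂₂ → Heis(ℤ/N)` (abc-iut-L2-t1's `hHat_eq_one_of_mem_closure`): the input of the root clause
`Ker(Π^tp ↠ Π^Θ) ∩ Π^tp_{Y_N} ≤ Π^tp_{Z_N}` at the χ-model. Model plumbing only; nothing of [EtTh] asserted; no side
taken on [IUTchIII] Cor. 3.12.
-/

noncomputable section

open Topology Function

namespace Literature.AnabelianGeometry.EtaleTheta.SettingModel

namespace Semidirect

/-- For a closed-embedding homomorphism, `Subgroup.map` commutes with topological closure.
[cite: MochizukiEtTh2009, §1 p.12] -/
theorem map_topologicalClosure_of_isClosedEmbedding {A B : Type*} [Group A] [Group B] [TopologicalSpace A]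
    [TopologicalSpace B] [IsTopologicalGroup A] [IsTopologicalGroup B] (f : A →* B) (hf : IsClosedEmbedding f)
    (H : Subgroup A) : (H.map f).topologicalClosure = (H.topologicalClosure).map f := by
  apply SetLike.coe_injective
  rw [Subgroup.topologicalClosure_coe, Subgroup.coe_map, Subgroup.coe_map, Subgroup.topologicalClosure_coe,
    hf.closure_image_eq]

/-- Membership form of `map_topologicalClosure_of_isClosedEmbedding`. [cite: MochizukiEtTh2009, §1 p.12] -/
theorem exists_of_mem_topologicalClosure_map {A B : Type*} [Group A] [Group B] [TopologicalSpace A]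
    [TopologicalSpace B] [IsTopologicalGroup A] [IsTopologicalGroup B] (f : A →* B) (hf : IsClosedEmbedding f)
    (H : Subgroup A) {b : B} (hb : b ∈ (H.map f).topologicalClosure) : ∃ a ∈ H.topologicalClosure, f a = b := by
  rw [map_topologicalClosure_of_isClosedEmbedding f hf H] at hb
  exact hb

variable {N G : Type*} [Group N] [Group G] {φ : G →* MulAut N}
  [TopologicalSpace N] [TopologicalSpace G] [TopologicalSpace (N ⋊[φ] G)]

/-- `inl : N → N ⋊_φ G` is a closed embedding (`N` compact, `G` Hausdorff, product-type topology).
[cite: MochizukiEtTh2009, §1 p.12] -/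
theorem isClosedEmbedding_inl (hι : IsInducing fun g : N ⋊[φ] G => (g.left, g.right)) [CompactSpace N] [T2Space N]
    [T2Space G] : IsClosedEmbedding (SemidirectProduct.inl : N → N ⋊[φ] G) := by
  haveI := t2Space_of hι
  exact (continuous_inl hι).isClosedEmbedding SemidirectProduct.inl_injective

/-- In `N ⋊_φ G` (as above, a topological group), the closure of `inl(H)` is `inl(H⁻)`; an element of it has trivial
`right` component and `left` component in `H⁻`. [cite: MochizukiEtTh2009, §1 p.12] -/
theorem left_mem_and_right_eq_one_of_mem_closure_map_inl (hι : IsInducing fun g : N ⋊[φ] G => (g.left, g.right))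
    [CompactSpace N] [T2Space N] [T2Space G] [IsTopologicalGroup N] [IsTopologicalGroup (N ⋊[φ] G)]
    (H : Subgroup N) {x : N ⋊[φ] G}
    (hx : x ∈ (H.map (SemidirectProduct.inl : N →* N ⋊[φ] G)).topologicalClosure) :
    x.left ∈ H.topologicalClosure ∧ x.right = 1 := by
  obtain ⟨a, ha, hax⟩ := exists_of_mem_topologicalClosure_map _ (isClosedEmbedding_inl hι) H hx
  subst hax
  exact ⟨by rw [SemidirectProduct.left_inl]; exact ha, SemidirectProduct.right_inl a⟩

end Semidirect

/-! ### The level maps on `[[Δ̂,Δ̂],Δ̂]⁻` for `Π = F̂₂ ⋊_ψ G` -/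

section HatLevels

variable {G : Type*} [Group G] [TopologicalSpace G] {ψ : G →* MulAut F₂hatT} [TopologicalSpace (F₂hatT ⋊[ψ] G)]

omit [TopologicalSpace G] [TopologicalSpace (F₂hatT ⋊[ψ] G)] in
/-- **`[[inl F̂₂, inl F̂₂], inl F̂₂] = inl([[F̂₂,F̂₂],F̂₂])`** in `F̂₂ ⋊_ψ G`. [cite: MochizukiEtTh2009, §1 p.12] -/
theorem commutator₃_range_inl_eq :
    ⁅⁅(SemidirectProduct.inl : F₂hatT →* F₂hatT ⋊[ψ] G).range, (SemidirectProduct.inl : F₂hatT →* F₂hatT ⋊[ψ] G).range⁆,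
      (SemidirectProduct.inl : F₂hatT →* F₂hatT ⋊[ψ] G).range⁆ =
      (⁅⁅(⊤ : Subgroup F₂hatT), (⊤ : Subgroup F₂hatT)⁆, (⊤ : Subgroup F₂hatT)⁆).map
        (SemidirectProduct.inl : F₂hatT →* F₂hatT ⋊[ψ] G) := by
  rw [MonoidHom.range_eq_map, Subgroup.map_commutator, Subgroup.map_commutator]

/-- **The level maps kill `[[Δ̂,Δ̂],Δ̂]⁻` when `Δ̂ = inl(F̂₂)`**: an element of the closure of
`[[inl F̂₂, inl F̂₂], inl F̂₂]` has `right = 1` and `ĥ_N(left) = 1` for every `N`. [cite: MochizukiEtTh2009, §1 p.14] -/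
theorem hHat_left_eq_one_of_mem_closure_commutator₃ (hι : IsInducing fun g : F₂hatT ⋊[ψ] G => (g.left, g.right))
    [T2Space G] [IsTopologicalGroup (F₂hatT ⋊[ψ] G)] {x : F₂hatT ⋊[ψ] G}
    (hx : x ∈ (⁅⁅(SemidirectProduct.inl : F₂hatT →* F₂hatT ⋊[ψ] G).range,
      (SemidirectProduct.inl : F₂hatT →* F₂hatT ⋊[ψ] G).range⁆,
      (SemidirectProduct.inl : F₂hatT →* F₂hatT ⋊[ψ] G).range⁆).topologicalClosure) (N : ℕ+) :
    hHat N x.left = 1 ∧ x.right = 1 := by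
  rw [commutator₃_range_inl_eq] at hx
  obtain ⟨hl, hr⟩ := Semidirect.left_mem_and_right_eq_one_of_mem_closure_map_inl hι _ hx
  exact ⟨hHat_eq_one_of_mem_closure N hl, hr⟩

/-- Closure-of-a-subgroup form: if `Δ ≤ inl(F̂₂)` then elements of `[[Δ,Δ],Δ]⁻` die under the level maps.
[cite: MochizukiEtTh2009, §1 p.14] -/
theorem hHat_left_eq_one_of_mem_closure_commutator₃_of_le (hι : IsInducing fun g : F₂hatT ⋊[ψ] G => (g.left, g.right))
    [T2Space G] [IsTopologicalGroup (F₂hatT ⋊[ψ] G)] {Δ : Subgroup (F₂hatT ⋊[ψ] G)}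
    (hΔ : Δ ≤ (SemidirectProduct.inl : F₂hatT →* F₂hatT ⋊[ψ] G).range) {x : F₂hatT ⋊[ψ] G}
    (hx : x ∈ (⁅⁅Δ, Δ⁆, Δ⁆).topologicalClosure) (N : ℕ+) : hHat N x.left = 1 ∧ x.right = 1 :=
  hHat_left_eq_one_of_mem_closure_commutator₃ hι
    (Subgroup.topologicalClosure_mono (Subgroup.commutator_mono (Subgroup.commutator_mono hΔ hΔ) hΔ) hx) N

/-- The image of a closed subset of `F̂₂` under `inl` is closed in `F̂₂ ⋊_ψ G` (used for `hYcl`: the image `inl(Ker ê)`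
of `Δ^tp_Y`). [cite: MochizukiEtTh2009, §1 p.12] -/
theorem isClosed_image_inl (hι : IsInducing fun g : F₂hatT ⋊[ψ] G => (g.left, g.right)) [T2Space G]
    {S : Set F₂hatT} (hS : IsClosed S) : IsClosed ((SemidirectProduct.inl : F₂hatT → F₂hatT ⋊[ψ] G) '' S) :=
  (Semidirect.isClosedEmbedding_inl hι).isClosedMap S hS

end HatLevels

end Literature.AnabelianGeometry.EtaleTheta.SettingModel

end
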